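import Summits.CriticalPhenomena.SAWScalingLimit.Theorems.SAWLeftRightFKGFKGToTraversalBoundTameRect
import HarnessLib

/-!
# Bounded convex domains are tame at every mesh (stubs `tamePresentation_of_convex`, `eventuallyTame_of_convex`)

Crux `SAWLeftRightFKG.FKGToTraversalBound` (stmt-CriticalPhenomena-1878), line `slit-necklace`, registered stubs
`tamePresentation_of_convex` and `eventuallyTame_of_convex`: every bounded convex planar set `Ω` has
`TamePresentation Ω δ 0` (`Theorems/SAWLeftRightFKGFKGToTraversalBoundSlitNecklaceDefs.lean`) at EVERY mesh `δ > 0`,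
hence every Dobrushin domain with convex carrier (discs, ellipses, convex polygons, …) is `EventuallyTame` with defect
budget `N₀ = 0` — the landed necklace reduction of the line applies to all of them.  Openness of `Ω` is not used.

**Proof** (the landed tool `tamePresentation_of_holeFree`,
`Theorems/SAWLeftRightFKGFKGToTraversalBoundTamePresentation.lean`, which needs NO connectivity of the discrete
domain — for a general convex set thin wedges at corners may leave small mesh components at every scale, and
`W = meshDomain Ω δ` is the union of the largest ones only).  Write `V = meshVertices Ω δ`.
* Box: `Ω ⊆ closedBall 0 R`, so every mesh vertex has both coordinates in `(-N, N)`, `N = ⌈R/δ⌉ + 1`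
  (`exists_meshVertices_box`).
* Induced: two lattice-adjacent mesh vertices span a segment of `Ω ⊆ closure Ω` (convexity), so they are
  mesh-adjacent (`meshGraph_adj_of_convex`).
* Rows are intervals: a site between two mesh vertices of its row is a mesh vertex (`mem_meshVertices_of_row`, convexity
  with the explicit barycentre `t = (z₀ - x₀)/(y₀ - x₀)`).
* Hole-freeness.  A site `k ∉ V` of the closed box: one of the two half-rows through `k` misses `V` (else `k`
  lies between two mesh vertices of its row), and the straight walk along it reaches the wall `z 0 = ±N` through
  sites off `V ⊇ W` (`escape_of_notMem_meshVertices`; straight/monotone walks by `exists_monotone_walk`,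
  iterating `exists_step_towards`).  A site `k ∈ V ∖ W`: its mesh component `A` is finite (`meshVertices_finite`)
  and disjoint from `W` (`W` is a union of whole components, `meshDomain_closed_of_reachable`); a site `m ∈ A`
  maximising the first coordinate has its east neighbour off `V` (an east neighbour in `V` would be mesh-adjacent,
  hence in `A`), so: walk inside `A` from `k` to `m` (`exists_zdWalk_of_reachable`), step east, escape as before
  (`escape_of_notMem_meshDomain`).
Then `eventuallyTame_of_convex` (`N₀ = 0`, every `δ > 0`); the unit disc (carrier `Metric.ball 0 1` of
`DobrushinDomain.unitDisc`) is the landed `eventuallyTame_unitDisc`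
(`Theorems/SAWLeftRightFKGFKGToTraversalBoundTameDisc.lean`).
No named fact; axioms are the standard three.
-/

noncomputable section

open Set Filter Topology
open Literature.Probability.LatticeModels Literature.Probability.RandomPlanarGeometry

namespace Summit.CriticalPhenomena.SAWScalingLimit.Theorems.FKGToTraversalBound.SlitNecklace

/-! ### Monotone lattice walks -/

/-- **Monotone staircase walks in `ℤ²`.**  Any two sites `x`, `v` are joined by a lattice walk all of whose
vertices lie coordinatewise between `x` and `v` (induction on the `ℓ¹` distance, one `exists_step_towards` at a
time).  In particular two sites of a row are joined by the straight walk along the row. [folklore] -/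
theorem exists_monotone_walk (v : Site 2) : ∀ (n : ℕ) (x : Site 2),
    (x 0 - v 0).natAbs + (x 1 - v 1).natAbs = n →
    ∃ p : (zdGraph 2).Walk x v, ∀ z ∈ p.support,
      ((x 0 ≤ z 0 ∧ z 0 ≤ v 0) ∨ (v 0 ≤ z 0 ∧ z 0 ≤ x 0)) ∧
      ((x 1 ≤ z 1 ∧ z 1 ≤ v 1) ∨ (v 1 ≤ z 1 ∧ z 1 ≤ x 1)) := by
  intro n
  induction n using Nat.strong_induction_on with
  | _ n ih =>
    intro x hn
    by_cases hxv : x = v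
    · subst hxv
      refine ⟨SimpleGraph.Walk.nil, fun z hz => ?_⟩
      rw [SimpleGraph.Walk.support_nil, List.mem_singleton] at hz
      subst hz
      omega
    obtain ⟨y, hadj, hy0, hy1, hlt⟩ := exists_step_towards x v hxv
    obtain ⟨p, hp⟩ := ih _ (hn ▸ hlt) y rfl
    refine ⟨SimpleGraph.Walk.cons hadj p, fun z hz => ?_⟩
    rw [SimpleGraph.Walk.support_cons, List.mem_cons] at hz
    rcases hz with rfl | hz
    · omega
    · have := hp z hz
      omega

/-! ### Convexity on the lattice: boxes, rows, components -/

variable {Ω : Set ℂ} {δ : ℝ}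

/-- **The mesh vertices of a bounded set lie in a lattice box**: if `Ω ⊆ closedBall 0 R` then every mesh vertex
at mesh `δ > 0` has both coordinates strictly between `-N` and `N`, where `N = ⌈R/δ⌉ + 1`
(`|δ xᵢ| ≤ ‖δx‖ ≤ R ≤ δ ⌈R/δ⌉ < δ N`). [folklore] -/
theorem exists_meshVertices_box (hbdd : Bornology.IsBounded Ω) (hδ : 0 < δ) :
    ∃ N : ℤ, ∀ x ∈ meshVertices Ω δ, -N < x 0 ∧ x 0 < N ∧ -N < x 1 ∧ x 1 < N := by
  obtain ⟨R, hR⟩ := (Metric.isBounded_iff_subset_closedBall (0 : ℂ)).1 hbdd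
  refine ⟨⌈R / δ⌉ + 1, fun x hx => ?_⟩
  have hz := hR hx
  rw [Metric.mem_closedBall, dist_zero_right] at hz
  have key : ∀ a : ℤ, |δ * (a : ℝ)| ≤ R → -(⌈R / δ⌉ + 1) < a ∧ a < ⌈R / δ⌉ + 1 := fun a ha => by
    rw [abs_mul, abs_of_pos hδ, mul_comm, ← le_div_iff₀ hδ] at ha
    obtain ⟨h1, h2⟩ := abs_le.1 ha
    have hc : R / δ ≤ (⌈R / δ⌉ : ℝ) := Int.le_ceil _
    constructor
    · have : ((-(⌈R / δ⌉ + 1) : ℤ) : ℝ) < a := by push_cast; linarith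
      exact_mod_cast this
    · have : ((a : ℤ) : ℝ) < ((⌈R / δ⌉ + 1 : ℤ) : ℝ) := by push_cast; linarith
      exact_mod_cast this
  have hre := key (x 0) (by simpa only [meshPoint_re] using (Complex.abs_re_le_norm _).trans hz)
  have him := key (x 1) (by simpa only [meshPoint_im] using (Complex.abs_im_le_norm _).trans hz)
  exact ⟨hre.1, hre.2, him.1, him.2⟩

/-- **Lattice neighbours among the mesh vertices of a convex set are mesh neighbours**: the segment joining the two
mesh points lies in the convex set `Ω ⊆ closure Ω`. [folklore] -/
theorem meshGraph_adj_of_convex (hconv : Convex ℝ Ω) {x y : Site 2} (hx : x ∈ meshVertices Ω δ)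
    (hy : y ∈ meshVertices Ω δ) (h : (zdGraph 2).Adj x y) : (meshGraph Ω δ).Adj x y :=
  meshGraph_adj_iff.2 ⟨h, (hconv.segment_subset hx hy).trans subset_closure⟩

/-- **Rows of the mesh vertices of a convex set are intervals**: a site `z` of the row of two mesh vertices `x`, `y`
with `x 0 ≤ z 0 ≤ y 0` is a mesh vertex — its mesh point is the barycentre `δx + t (δy - δx)`,
`t = (z₀ - x₀)/(y₀ - x₀) ∈ [0, 1]` (also correct, with `t = 0`, in the degenerate case `x₀ = y₀`).
[folklore] -/
theorem mem_meshVertices_of_row (hconv : Convex ℝ Ω) {x y z : Site 2} (hx : x ∈ meshVertices Ω δ)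
    (hy : y ∈ meshVertices Ω δ) (hz1 : z 1 = x 1) (hy1 : y 1 = x 1) (hxz : x 0 ≤ z 0) (hzy : z 0 ≤ y 0) :
    z ∈ meshVertices Ω δ := by
  rw [mem_meshVertices_iff] at hx hy ⊢
  set t : ℝ := ((z 0 : ℝ) - x 0) / ((y 0 : ℝ) - x 0) with ht
  have hxz' : ((x 0 : ℤ) : ℝ) ≤ z 0 := by exact_mod_cast hxz
  have hzy' : ((z 0 : ℤ) : ℝ) ≤ y 0 := by exact_mod_cast hzy
  have ht01 : t ∈ Icc (0 : ℝ) 1 :=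
    ⟨div_nonneg (by linarith) (by linarith), div_le_one_of_le₀ (by linarith) (by linarith)⟩
  have hkey : t * ((y 0 : ℝ) - x 0) = (z 0 : ℝ) - x 0 := by
    rcases eq_or_ne ((y 0 : ℝ) - x 0) 0 with h | h
    · rw [h, mul_zero]; linarith
    · exact div_mul_cancel₀ _ h
  have h1 : ((z 1 : ℤ) : ℝ) = x 1 := by exact_mod_cast hz1
  have h1' : ((y 1 : ℤ) : ℝ) = x 1 := by exact_mod_cast hy1
  have hpt : meshPoint δ x + t • (meshPoint δ y - meshPoint δ x) = meshPoint δ z := by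
    apply Complex.ext
    · simp only [Complex.add_re, Complex.smul_re, Complex.sub_re, meshPoint_re, smul_eq_mul]
      linear_combination δ * hkey
    · simp only [Complex.add_im, Complex.smul_im, Complex.sub_im, meshPoint_im, smul_eq_mul]
      linear_combination δ * t * h1' - δ * h1
  rw [← hpt]
  exact hconv.add_smul_sub_mem hx hy ht01

/-- **The discrete domain is a union of whole mesh components**: a mesh vertex joined in the mesh vertex graph to a
site of `W = meshDomain Ω δ` belongs to `W`. [folklore] -/
theorem meshDomain_closed_of_reachable {x k : Site 2} (hx : x ∈ meshVertices Ω δ) (hk : k ∈ meshVertices Ω δ)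
    (h : (meshVertexGraph Ω δ).Reachable ⟨x, hx⟩ ⟨k, hk⟩) (hxW : x ∈ meshDomain Ω δ) :
    k ∈ meshDomain Ω δ := by
  simp only [meshDomain, Set.mem_iUnion, Set.mem_image] at hxW ⊢
  obtain ⟨C, hC, x', hx'C, hx'x⟩ := hxW
  obtain rfl : x' = ⟨x, hx⟩ := Subtype.ext hx'x
  refine ⟨C, hC, ⟨k, hk⟩, ?_, rfl⟩
  rw [SimpleGraph.ConnectedComponent.mem_supp_iff] at hx'C ⊢
  rw [← hx'C]
  exact SimpleGraph.ConnectedComponent.sound h.symm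

/-- **A mesh component is traced by a lattice walk**: two mesh vertices joined in the mesh vertex graph are joined by a
lattice walk all of whose vertices are mesh vertices of the same component (map the walk down to `ℤ²`). [folklore] -/
theorem exists_zdWalk_of_reachable {k m : Site 2} (hk : k ∈ meshVertices Ω δ) (hm : m ∈ meshVertices Ω δ)
    (h : (meshVertexGraph Ω δ).Reachable ⟨k, hk⟩ ⟨m, hm⟩) :
    ∃ p : (zdGraph 2).Walk k m, ∀ z ∈ p.support,
      ∃ hz : z ∈ meshVertices Ω δ, (meshVertexGraph Ω δ).Reachable ⟨k, hk⟩ ⟨z, hz⟩ := by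
  classical
  obtain ⟨q⟩ := h
  let φ : meshVertexGraph Ω δ →g zdGraph 2 := ⟨Subtype.val, fun h => meshGraph_le_zdGraph Ω δ h⟩
  refine ⟨q.map φ, fun z hz => ?_⟩
  rw [SimpleGraph.Walk.support_map, List.mem_map] at hz
  obtain ⟨a, ha, rfl⟩ := hz
  exact ⟨a.2, ⟨q.takeUntil a ha⟩⟩

/-! ### Escape walks to the walls of the box -/

/-- **Escape from a site off the mesh vertices of a convex set.**  If `k ∉ V = meshVertices Ω δ` lies in the
closed box `[-N, N]²`, then one of the two half-rows through `k` misses `V` (otherwise `k` lies between two mesh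
vertices of its row, `mem_meshVertices_of_row`), and the straight walk along it joins `k` to the wall `z 0 = -N` or
`z 0 = N` through sites of the closed box off `V`. [folklore] -/
theorem escape_of_notMem_meshVertices (hconv : Convex ℝ Ω) {N : ℤ} {k : Site 2} (hk : k ∉ meshVertices Ω δ)
    (h0 : -N ≤ k 0) (h0' : k 0 ≤ N) (h1 : -N ≤ k 1) (h1' : k 1 ≤ N) :
    ∃ (q : Site 2) (p : (zdGraph 2).Walk k q), (q 0 = -N ∨ q 0 = N ∨ q 1 = -N ∨ q 1 = N) ∧
      ∀ z ∈ p.support, z ∉ meshVertices Ω δ ∧ -N ≤ z 0 ∧ z 0 ≤ N ∧ -N ≤ z 1 ∧ z 1 ≤ N := by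
  -- one of the two half-rows through `k` misses the mesh vertices
  have hray : (∀ z : Site 2, z 1 = k 1 → k 0 ≤ z 0 → z ∉ meshVertices Ω δ) ∨
      (∀ z : Site 2, z 1 = k 1 → z 0 ≤ k 0 → z ∉ meshVertices Ω δ) := by
    by_contra h
    push Not at h
    obtain ⟨⟨y, hy1, hky, hyV⟩, ⟨x, hx1, hxk, hxV⟩⟩ := h
    exact hk (mem_meshVertices_of_row hconv hxV hyV hx1.symm (hy1.trans hx1.symm) hxk hky)
  rcases hray with hE | hW
  · -- walk east to the wall `z 0 = N`
    obtain ⟨p, hp⟩ := exists_monotone_walk ![N, k 1] _ k rfl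
    refine ⟨_, p, Or.inr (Or.inl (by simp)), fun z hz => ?_⟩
    obtain ⟨hz0, hz1⟩ := hp z hz
    simp only [Matrix.cons_val_zero, Matrix.cons_val_one, Matrix.cons_val_fin_one] at hz0 hz1
    exact ⟨hE z (by omega) (by omega), by omega, by omega, by omega, by omega⟩
  · -- walk west to the wall `z 0 = -N`
    obtain ⟨p, hp⟩ := exists_monotone_walk ![-N, k 1] _ k rfl
    refine ⟨_, p, Or.inl (by simp), fun z hz => ?_⟩
    obtain ⟨hz0, hz1⟩ := hp z hz
    simp only [Matrix.cons_val_zero, Matrix.cons_val_one, Matrix.cons_val_fin_one] at hz0 hz1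
    exact ⟨hW z (by omega) (by omega), by omega, by omega, by omega, by omega⟩

/-- **Escape from a mesh vertex off the discrete domain of a bounded convex set.**  Let the mesh vertices `V` lie in the
open box `(-N, N)²` and let `k ∈ V ∖ W`, `W = meshDomain Ω δ`.  The mesh component `A ∋ k` is finite and
disjoint from `W`; a site `m ∈ A` maximising the first coordinate has its east neighbour off `V` (it would
otherwise be mesh-adjacent to `m`, hence in `A`); the escape walk runs inside `A` from `k` to `m`, steps east, and
continues by `escape_of_notMem_meshVertices` — through sites of the closed box off `W`, to a wall. [folklore] -/
theorem escape_of_notMem_meshDomain (hconv : Convex ℝ Ω) (hbdd : Bornology.IsBounded Ω) (hδ : 0 < δ) {N : ℤ}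
    (hbox : ∀ x ∈ meshVertices Ω δ, -N < x 0 ∧ x 0 < N ∧ -N < x 1 ∧ x 1 < N) {k : Site 2}
    (hkV : k ∈ meshVertices Ω δ) (hkW : k ∉ meshDomain Ω δ) :
    ∃ (q : Site 2) (p : (zdGraph 2).Walk k q), (q 0 = -N ∨ q 0 = N ∨ q 1 = -N ∨ q 1 = N) ∧
      ∀ z ∈ p.support, z ∉ meshDomain Ω δ ∧ -N ≤ z 0 ∧ z 0 ≤ N ∧ -N ≤ z 1 ∧ z 1 ≤ N := by
  -- the mesh component of `k`, as a set of sites: finite, off `W`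
  set A : Set (Site 2) :=
    {x | ∃ hx : x ∈ meshVertices Ω δ, (meshVertexGraph Ω δ).Reachable ⟨k, hkV⟩ ⟨x, hx⟩} with hA
  have hAfin : A.Finite := (meshVertices_finite hbdd hδ).subset fun x ⟨hx, _⟩ => hx
  have hkA : k ∈ A := ⟨hkV, SimpleGraph.Reachable.refl _⟩
  have hAW : ∀ x ∈ A, x ∉ meshDomain Ω δ := fun x ⟨hx, hr⟩ hxW =>
    hkW (meshDomain_closed_of_reachable hx hkV hr.symm hxW)
  -- a site of the component maximising the first coordinate; its east neighbour is off `V`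
  obtain ⟨m, ⟨hmV, hkm⟩, hmax⟩ := A.exists_max_image (fun x => x 0) hAfin ⟨k, hkA⟩
  have hadj : (zdGraph 2).Adj m (m + Pi.single 0 1) := (zdGraph_adj_iff _ _).2 ⟨0, Or.inl rfl⟩
  have hm' : m + Pi.single 0 1 ∉ meshVertices Ω δ := by
    intro h
    have hr : (meshVertexGraph Ω δ).Reachable ⟨k, hkV⟩ ⟨m + Pi.single 0 1, h⟩ :=
      hkm.trans (SimpleGraph.Adj.reachable
        (show (meshVertexGraph Ω δ).Adj ⟨m, hmV⟩ ⟨_, h⟩ from meshGraph_adj_of_convex hconv hmV h hadj))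
    have := hmax _ ⟨h, hr⟩
    simp only [Pi.add_apply, Pi.single_eq_same] at this
    omega
  obtain ⟨hm0, hm0', hm1, hm1'⟩ := hbox m hmV
  -- escape from the east neighbour, and the walk inside the component from `k` to `m`
  obtain ⟨q, p₂, hq, hp₂⟩ := escape_of_notMem_meshVertices (N := N) hconv hm'
    (by simp only [Pi.add_apply, Pi.single_eq_same]; omega)
    (by simp only [Pi.add_apply, Pi.single_eq_same]; omega)
    (by simp only [Pi.add_apply, Pi.single_eq_of_ne one_ne_zero, add_zero]; omega)
    (by simp only [Pi.add_apply, Pi.single_eq_of_ne one_ne_zero, add_zero]; omega)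
  obtain ⟨p₁, hp₁⟩ := exists_zdWalk_of_reachable hkV hmV hkm
  refine ⟨q, p₁.append (SimpleGraph.Walk.cons hadj p₂), hq, fun z hz => ?_⟩
  rw [SimpleGraph.Walk.mem_support_append_iff, SimpleGraph.Walk.support_cons, List.mem_cons] at hz
  rcases hz with hz | rfl | hz
  · obtain ⟨hzV, hr⟩ := hp₁ z hz
    obtain ⟨hz0, hz0', hz1, hz1'⟩ := hbox z hzV
    exact ⟨hAW z ⟨hzV, hr⟩, by omega, by omega, by omega, by omega⟩
  · exact ⟨hAW _ ⟨hmV, hkm⟩, by omega, by omega, by omega, by omega⟩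
  · obtain ⟨hzV, hz0, hz0', hz1, hz1'⟩ := hp₂ z hz
    exact ⟨fun h => hzV (meshDomain_subset_meshVertices _ _ h), hz0, hz0', hz1, hz1'⟩

/-! ### The registered stubs -/

/-- **Registered stub `tamePresentation_of_convex`** (line `slit-necklace`, crux stmt-CriticalPhenomena-1878).
Every bounded convex planar set `Ω` is tame with NO defect at EVERY mesh `δ > 0`: `TamePresentation Ω δ 0`, i.e. the
graph `Ω_δ` IS the graph of an r2 carrier.  By `tamePresentation_of_holeFree` with the box of
`exists_meshVertices_box`: the discrete domain is induced (`meshGraph_adj_of_convex`) and hole-free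
(`escape_of_notMem_meshVertices`, `escape_of_notMem_meshDomain`).  Openness is part of the registered signature
but is not used. [folklore] -/
theorem tamePresentation_of_convex : ∀ (Ω : Set ℂ) (δ : ℝ), Convex ℝ Ω → IsOpen Ω →
    Bornology.IsBounded Ω → 0 < δ → TamePresentation Ω δ 0 := by
  intro Ω δ hconv _ hbdd hδ
  obtain ⟨N, hbox⟩ := exists_meshVertices_box hbdd hδ
  refine tamePresentation_of_holeFree Ω δ (-N) N (-N) N hδ
    (fun x hx => hbox x (meshDomain_subset_meshVertices _ _ hx))
    (fun x hx y hy h => meshGraph_adj_of_convex hconv (meshDomain_subset_meshVertices _ _ hx)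
      (meshDomain_subset_meshVertices _ _ hy) h)
    (fun k h1 h2 h3 h4 hk => ?_)
  by_cases hkV : k ∈ meshVertices Ω δ
  · exact escape_of_notMem_meshDomain hconv hbdd hδ hbox hkV hk
  · obtain ⟨q, p, hq, hp⟩ := escape_of_notMem_meshVertices hconv hkV h1 h2 h3 h4
    exact ⟨q, p, hq, fun z hz =>
      ⟨fun h => (hp z hz).1 (meshDomain_subset_meshVertices _ _ h), (hp z hz).2⟩⟩

/-- **Registered stub `eventuallyTame_of_convex`** (line `slit-necklace`, crux stmt-CriticalPhenomena-1878).
A Dobrushin domain with convex carrier is eventually tame, with defect budget `N₀ = 0`: at every mesh `δ > 0` its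
discretisation `Ω_δ` is the graph of an r2 carrier with no defect (`tamePresentation_of_convex`), in particular
eventually as `δ → 0⁺`. [folklore] -/
theorem eventuallyTame_of_convex : ∀ D : DobrushinDomain, Convex ℝ D.carrier → EventuallyTame D :=
  fun D hD => ⟨0, eventually_nhdsWithin_of_forall fun δ hδ =>
    tamePresentation_of_convex D.carrier δ hD D.isOpen D.isBounded hδ⟩

/-- **Tameness of convex Dobrushin domains at every mesh** (not only eventually): for a Dobrushin domain with convex
carrier, `TamePresentation D.carrier δ 0` for every `δ > 0`. [folklore] -/
theorem tamePresentation_of_convex_dobrushin (D : DobrushinDomain) (hD : Convex ℝ D.carrier) {δ : ℝ}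
    (hδ : 0 < δ) : TamePresentation D.carrier δ 0 :=
  tamePresentation_of_convex D.carrier δ hD D.isOpen D.isBounded hδ

end Summit.CriticalPhenomena.SAWScalingLimit.Theorems.FKGToTraversalBound.SlitNecklace

end
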